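import Summits.BirchSwinnertonDyer.Rank1Residual.Supersingular.KobayashiMainConjectureX6BSTWScopeThree
import HarnessLib

/-!
# The two tiers of the cell's reading of Burungale–Skinner–Tian–Wan Thm. 1.3 WITHOUT the class-number rider (α) —
# scope `S1 ∧ S2` only — as typed OPEN binders (`p ≥ 5` and `p = 3`), with their class-X6 consumers (cell
# `bsd-ssimc`, seat `bsd-ssimc-k3-c2` gen 6, filing the one-definition re-typing announced by seat `bsd-ssimc-bstw`
# gen 9 in bstw-MEMO-9 §6(2) / addA A.3 / addB and drafted by it for the `p ≥ 5` tier
# (HOME/bstw/KobayashiMainConjectureX6BSTWScopeS-DRAFT.lean); route `SignedLowerHalves` item 2 =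
# stmt-BirchSwinnertonDyer-19000 `KobayashiLowerHalfSemistable`, registered stubs `stub_five_le` / `stub_three`)

HONEST FRAMING (cell README §4): nothing here is a theorem about any curve; an ANNOUNCED preprint (BSTW,
arXiv:2409.01350v2) enters ONLY as explicitly labelled OPEN binders (`…_OPEN : Prop`, `[claim: …, under-review]`,
NEVER a theorem); published results are consumed BY NAME; BSD is not proved by any of this; the crux
`KobayashiLowerHalfSemistable` stays OPEN on the ledger. PARTITION (D-0054): X6 ∧ r = 0 (A6) × 13 (+10~) × p ∈ {3,5}
+ X6 r1 + literal row D2 — types-the-object-of; closes none; nothing is booked by this file.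

## Why this file

The binders of record for the two tiers, `BurungaleSkinnerTianWan2024_thm13_scoped_OPEN` (`p ≥ 5`,
`KobayashiMainConjectureX6BSTWScope.lean`, k3-c2 gen 0) and `…_scopedAtThree_OPEN` (`p = 3`,
`KobayashiMainConjectureX6BSTWScopeThree.lean`, k3-c2 gen 2), carry the scope witness `BSTWScope.HasWitness W p` =
S1 (a (ram) prime `q`) ∧ S2 + G3 (an auxiliary imaginary quadratic `L`: `p` split, `q` inert, `N/q` split, `2` split
if good, `(d_L, 2N) = 1`) ∧ (α) (`p ∤ h_L`) — the rider (α) being the referee's NOTE-W-ref-2 reading of bstw-MEMO-6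
B.1. Two cell inputs bear on (α) at EVERY odd `p`:
* S1 ∧ S2 is FREE class-wide — a THEOREM (bstw gen 9: Literature theorem
  `Quadratic.exists_imaginaryQuadratic_split_inert'`, Dirichlet + CRT + decomposition law, p438352;
  `BSTWScope_exists_auxField_of_goodSS`, p438787);
* bstw-MEMO-9 (626211cba73919ef) + addA (de517f28a83a79cc) + addB (b16856770569f647) ARGUE that the ONE
  `h_L`-sensitive point of record never occurs — `Γ_L = Γ_L^cyc × Γ_L^v` for EVERY auxiliary `L` with `p` split,
  `p` odd (the cell's refereed Lemma I(ii)), so C.2(ii) = Rohrlich 1989 is never invoked — i.e. «(α) void» at `p ≥ 5`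
  (MEMO-9) and at `p = 3` (addB: the argument is `p`-uniform). Whether that is the cell's reading OF RECORD is the
  referee's to grade (REPORT-bstw-9, pending when this file was written); until PASS the rider STANDS in TARGET l.2.
p438787 / p440592 state the class-number-free readings INLINE (`hS`, `hS5`, `hS3`). This file gives them THEIR NAMES,
exactly as the two existing tiers are named — a VERDICT-NEUTRAL re-typing (planner ORDERS v12.6: «a re-typing names a
weaker binder; it does not assert the rider void»): each new `Prop` sits strictly between the printed claim and the
corresponding binder of record (sandwich lemmas below) and asserts nothing. With the names, the crux, the registered
stubs `stub_five_le` / `stub_three` and the A6 / D2 consumers read modulo ONE named `Prop` per tier and PUBLISHED facts —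
with NO class-number statement, NO Bhargava–Varma input and NO per-class witness
(`Theorems/SignedLowerHalvesKobayashiLowerHalfSemistableScopeS.lean`).

## Contents

* `BSTWScope.HasAuxWitness W p` — S1 ∧ S2 (+ G3), class-number-free: `∃ q L, IsAuxiliaryPrime W p q ∧
  IsAuxiliaryField W p q L`. A THEOREM for every semistable `W` at every odd good supersingular `p`
  (`BSTWScope_exists_auxField_of_goodSS`, p438787; not restated here). `hasAuxWitness_of_hasWitness`;
  `hasWitness_or_forall_dvd_classNumber` (the dichotomy behind p438787's corner hypothesis `hα`).
* `BurungaleSkinnerTianWan2024_thm13_scopedS_OPEN` — the `p ≥ 5` tier: `5 ≤ p`, `Semistable W`, `GoodSS W p`,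
  `HasAuxWitness W p` ⟹ `KobayashiMainConjecture W p ε` for every sign. NEVER a theorem.
* `BurungaleSkinnerTianWan2024_thm13_scopedAtThreeS_OPEN` — the `p = 3` tier: `p = 3`, `Semistable W`, `GoodSS W p`,
  `a₃ = 0`, `HasAuxWitness W p` ⟹ the same. NEVER a theorem. Rests, beyond the `p ≥ 5` chain, on the located residual
  (3-ii)♭ (REPORT-bstw-7; flag `BSTW13-p3-OhtaES-preprint`), exactly as the `p = 3` binder of record.
* Sandwiches: each S-scoped binder is implied by the printed binder (`…_of_thm13_OPEN`) and implies the corresponding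
  binder of record (`thm13_scoped_OPEN_of_thm13_scopedS_OPEN`, `thm13_scopedAtThree_OPEN_of_thm13_scopedAtThreeS_OPEN`).
  Modulo modularity + Diamond/Ribet each is EQUIVALENT to the printed claim restricted to its regime with no scope
  hypothesis at all (Theorems-side `thm13_scopedS_OPEN_iff_fiveLe` / `thm13_scopedAtThreeS_OPEN_iff_three`).
* Consumers on class X6 GIVEN a class-number-free witness `hw` (mirrors of the gen-0 / gen-2 consumers): the main
  conjecture, its Eisenstein half (`KobayashiLowerDivisibility`, the crux's predicate), `BSD(E,p)` in analytic rank 0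
  (± road) at `p ≥ 5` and at `p = 3`, and in rank 1 (BKO Cor. A.5 road) at `p ≥ 5`. The witness-FREE forms (which
  need the Theorems-side p438787) live in the companion Theorems file.

What this file is NOT: not a claim that BSTW Thm. 1.3 holds; not a verification (that is bstw-MEMO-1…9 +
REPORT-bstw-1…9); not a booking (A6 @ p ≥ 5 and @ 3, D2 remain PRE-tier in the lane's currency); not a typing of
(3-ii)♭.

## Litref D-audit of record (cell `pub/bsd-litref`, tranche T2b, 2026-08-26)

Reading of record `pub/bsd-litref/bstw24/sheets/D-AUDIT-bstw24-r1.md` 2ab68891cb7b08bc + ADDENDA 1–5 (dd57a5d99fb5bd7f /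
5fc2aa1cce88a1ac / f18da4daf35aa2e0 / 14b633e2f406b0ef / 73386cd869069474; the located lines are quoted in
`KobayashiMainConjectureX6BSTWScopeThree.lean` § «Litref D-audit»). PRINTED NUMBERING (arXiv v2; TeX sha16
5926f035551c636d; the cell memos use the held extraction's numbering, one section low in Part I and restarted in Part II
— full map in `KobayashiMainConjectureX6BSTWScopeThree.lean`): «Rem. 5.1» = printed Rem. 6.1 (p. 58); «§3.2.3» = §4.2.3
(p. 34); «Part II §2.3 / Thm. 2.1 / Thm. 2.5 / Thm. 1.24 / Prop. 1.18» = §10.3 / Thm. 10.1 (p. 86) / Thm. 10.5 (p. 87) /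
Thm. 9.24 (p. 85) / Prop. 9.18 (p. 83). Per tier: `…_thm13_scopedS_OPEN` (p ≥ 5) — r1 O6: architecture PASS; print
GAPPED-in-print at the §6 normalisation (G-ii: `J_g` of l.5040–5043 vs Thm. 6.8 (ii) l.5210–5222, factor
((1−pγ⁻²)(1−γ⁻²)λ_N(g))⁻¹ = p/(2(p+1)λ_N(g)) at γ² = −p, valuation +1 at every odd p, re-derived in r1 §10; = the cell's
CB10, repaired of record by its (R1)) and at Thm. 9.24's proof l.7275–7286 (G-i; ADDENDUM-1: component (i) withdrawn at
p ≥ 5 as a [CLW22] label erratum, (ii) integrality sentence not load-bearing, (iii) interpolation identification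
unprinted = bookkeeping); ADDENDUM-2 (5fc2aa1cce88a1ac) RE-VERIFIED the cell repairs first-hand (Theorem A / Cor B /
Lemma N / Theorem G1♮, PUB inputs opened at the page, valuations redone: CONCUR) and ADDENDUM-3 (f18da4daf35aa2e0)
re-derived Theorem G1♮′ for EVERY auxiliary L (a″ ≥ 0) ⇒ O6 @ p ≥ 5 = **PASS-in-cell WITH THE CELL REPAIRS** (second,
independent reader), class-number-free on the auxiliary field per r1 — a reading now DISPUTED ACROSS DESKS: cgs25-r2's
Q1 locates a GAP(line) in printed Prop. 4.12's proof (TeX l.3385–3386, «from which the proposition follows … it suffices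
to show that the minimal number of generators …») at h_p(L) ≥ 1, and referee C ROUND 381 (2026-08-26T23:25:38Z, cgs25
group) records for C4 «counterexample VALID, the «it suffices» inference INCOMPLETE as worded …, VACUOUS at h_p(L) = 0»
and «the r2-vs-bstw24-r1 disagreement STANDS», «NOT finally adjudicated here» (final word referee C4's); reader 1
ADDENDUM-5 73386cd869069474 then CONCEDES the wording lacuna («for the sentence l.3383–3386 the word «correct as
printed» is WITHDRAWN») and REPAIRS the inference from the proof's own inputs — Lemma S (saturation from t⁺ ∉ XT once
X·(T⁻)_tors = 0) + Lemma T ((𝐓⁻_P)_tors ≅ k² X-semisimple, computed from [BD, Thm. B]'s ring structure in all three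
cases) — ⇒ on r1's word Prop. 4.12 «PASS-in-cell WITH READER REPAIR», (Ind) / Thms. 5.19–5.20 stand at every h_p;
ADMISSION of the repair is referee C4's (reader 2 ADDENDUM-6 eaa05811605d1147, blind to r1, independently CONCURS that
the inference is incomplete as worded, types the missing input, offers no repair of its own and records avoidance by the
proof's free choice of the auxiliary field — its rider (R-d)); the S-scoped tiers of this file (witness `HasAuxWitness`,
no condition on h_L) are exactly the tiers that regime touches, the (α)-scoped tier `…_thm13_scoped_OPEN` (p ∤ h_L ⇒ h_p
= 0, TeX l.2711–2713; Props. 4.10 / 4.12 vacuous, R381 (d)(ii)) is not —, print gapped-as-printed at the two located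
lines (errata, harmless for the theorem) — details in `KobayashiMainConjectureX6BSTWScope.lean` § «Litref D-audit»;
`…_thm13_scopedAtThreeS_OPEN` (p = 3) — r1 O5: GAP(line) at the note after Thm. 4.1 (TeX l.2915, p. 34) and Rem. 6.1
(l.4918–4922, p. 58) ⇐ [SV-S-Ohta] (unpublished, unlocated 2026-08-26) + Cais 2018 (partial) — the same object as
(3-ii)♭. Prong map of record for the Ohta-ES@3 node (referee C R361, sharpening R353 (ζ)): the supersingular rows —
these tiers — «engage G♭ only» (reader 1 ADDENDUM-4 §A.2 re-finds this first-hand: Coleman family on the g-side, [LZ16]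
p > 2, [AIS15] p ≥ 3 incl. p = 3; [BL]'s p ≥ 5 standing an input-level rider) (G♭ = the package for the CM family 𝐡_v at
(3, ω^{−1}), open-curve row at its Eisenstein ideal ⇐ [SV-S-Ohta]); the ordinary rows (A10 via hA, D4@3, D3) engage G♭ ∧
G♯ (g-side family at (3, ω⁰); R381 (θ): D4 — ordinary-Eisenstein g-side — is a THIRD class, G♯^{Eis} ∧ G♭ ∧ the
l.4175–4176 normalisation; A10's Eisenstein relatives await C4's class word); details and the verbatim desk sentences in
`KobayashiMainConjectureX6BSTWScopeThree.lean` § «Litref D-audit». Reader 2 (INDEPENDENT; `D-AUDIT-bstw24-r2.md` sha16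
69e4de3690fd21dc FROZEN + ADDENDUM-1 850c38dd32e26b8a + ADDENDUM-2 429d6b8a4b7ba185 + ADDENDUM-3 4e4fd1ddbfa9f33b +
ADDENDUM-4 f739c7b8993da616 + ADDENDUM-5 e7ed9540d359d276 + ADDENDUM-6 eaa05811605d1147), verdict N2 on the K3 binders
T1–T4 and these tiers: statements VERBATIM / weaker-than-print twist clause; proof side NOT re-audited by r2 (of record
= bsd-ssimc BSTW-verification-v3 2c152cd7c8940032) EXCEPT the supersingular §6.2 normalisation — ADDENDUM-4
f739c7b8993da616 re-derives, from the TeX alone (reader 1's record unopened), Thm. 6.4's constant p/(2(p+1)λ_N(g)) off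
Thm. 6.8 (ii) ∧ Prop. 6.7 ∧ Thm. 6.2 at every t > 0 (both parities; γ drops out), the t = 0 indeterminacy (cross term)
and its source, the two «J_g» (l.5037–5043 vs l.5141–5150; Lemma 6.6's proof l.5251–5267): CONCUR with r1 (G-ii) / the
cell's CB10, downstream propagation left to r1 / bsd-ssimc —; r2's new g-side component G3g (KLZ17 7.2.3 / 9.5.1–2 /
10.1.1 / 10.2.2 at 3 on the trivial tame eigenspace, tame level N) concerns the ORDINARY §5 package behind CGS25 Thm.
4.1.1 and does NOT touch Thm. 1.3's supersingular §6 (no g-side Hida family); input census of record for the Ohta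
package at 3 = r2 ADDENDUM-2 rows C1–C12 (every printed leg p ≥ 5 or eigenspace-excluding; Wake arXiv:1303.0406
withdrawn; [SV-S-Ohta] non-public — summarised in `KobayashiMainConjectureX6BSTWScopeThree.lean` § «Litref D-audit»).
The A10 / hA-side twin of this prime-tier split is
`Summit.BirchSwinnertonDyer.Rank1Residual.RowC6.CastellaGrossiSkinner2025_thmA_atThree_OPEN` (p461118). Consumers: the
litref prover's re-routes `Theorems/SignedLowerHalvesRowC3BSTWScopeS.lean` (p455876 / p457879) and
`Theorems/SignedLowerHalvesCoveredAllPrimesBSTWScopeS.lean` (p464693). Statement side (r1 O1): VERBATIM / weaker than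
print — no binder fix. Referee desks on this reading (D-audit desk = referee C4 `pub-bsdpct-r7` since 2026-08-26T22:54Z
(litref wakes MOVED r3 → r7, one family per round; director-bsd 22:55:33Z), before that referee C `pub-bsdpct-r3` (from
19:21Z) and C2 `pub-bsdpct-r4`; wakes WAKE-AUDIT-LITREF-bstw24-r1-2ab68891cb7b08bc + -add1, -add2, -add3, -add4, -add5,
-r2-69e4de3690fd21dc + -add1, -add2, -add3, -add4, -add5, -add6): referee C ROUND 353 (ε)/(ζ) (2026-08-26T20:27:48Z,
jsw17 group) — «Road K @ p ≥ 5 PASS-in-cell at the tier of record (ONE PRE binder `thm13_scopedS_OPEN`, cell-verified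
regime, REPORT-bstw-6∕-9) … @ 3: GAP((3-ii)♭) both roads — CONCUR ×2, RELAY-6 stands» and the register-wide word on the
Ohta-ES@3 node «CONFIRMED-as-flag wherever it appears — rows D2@3 (RELAY-6), D3 (YZ26@3-BF-ERL-Ohta), A10 (T-EISRG3C
cells @3), D4@3 (CGS 4.1.1 ← [BST]/BSTW §5)»; referee C4's bstw24 family round: ROUND C4-R3 (2026-08-27T00:54:31Z,
referee C4 pub-bsdpct-r7; one slot, 12 wakes: r1 2ab68891 + ADD-1…5, r2 69e4de36 + ADD-1…5; r2 ADD-6 eaa05811 to be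
graded as a rider): (α) statement audits «thm13_OPEN and thm15_pPart_OPEN VERBATIM; the X7-twist and thm15-twist binders
WEAKER-than-print (intro wording; safe direction) … PASS ×2 CONCUR» — no RETURN(line) or SMUGGLED(line) ⇒ 0 binder
fixes; (β) §5 @ p = 3 «GAP(line), VERDICT OF RECORD» (l.2915 + l.4918–4923; strike rule = G♭ ∧ G♯^{Eis} ∧ l.4175–4176 at
3; «all A10 T-EISRG3C cells STAY LITERAL … 0 move»; «Same wall governs K3 W1 @3»); (γ) §5 @ p ≥ 5 «PASS-in-cell MODULO
PUB inputs, VERDICT OF RECORD», riders (R-a), (R-b), l.4175–4176 on (anom); (δ) l.4175–4176 printed-unproved CONFIRMED,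
Lemma W admission HELD OPEN; (ε) Q1 «INCOMPLETE AS WORDED», Prop. 4.12 holds via r1 ADD-5 Lemma S + T «VERIFIED AT THIS
DESK» ⇒ «PASS-in-cell WITH READER REPAIR», disagreement «DISSOLVED BY CONCESSION»; (ζ) O6, O7 @ p ≥ 5 «PASS-in-cell WITH
CELL REPAIRS, CONCUR ×2»; 0 cells move; referee A: not seized of a docstring-bearing word on this paper —
GAP(line) @ 3 ⇒ 0 move (A10 register: 32 T-EISRG3C keys at the lead-B count, 31 at the A fold, CONFIRMED-as-flag
register-wide: referee C R353 (ζ), R361 (ε), A R376.4); C4-R3 (θ) opens the pricing gate — the PRICING-A10-TEISRG3C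
record of bsd-litref-bstw24-pv goes to A, and its eventual word rides the next substantive edit of this file (cell
ruling 2026-08-26T21:02:36Z). Statements in this file are UNCHANGED by the litref pass (typer `bsd-litref-bstw24-ty`).

References: [BurungaleSkinnerTianWan2024] Thm. 1.3, Rem. 5.1, Part II §2.3 / Thm. 2.1 (PRE; = printed Rem. 6.1,
§10.3 / Thm. 10.1); [Kobayashi2003]
Conjecture (p. 2); [SkinnerUrban2014] Thm. 2 (ram); [Wuthrich2014] Prop. 21; [Miller2011LMS] Def. 1.1;
[BurungaleKobayashiOta2023] Cor. A.5; cell records REPORT-bstw-6 (7a95ba616d84dc36), REPORT-bstw-7 (40fdbe7e627732c4),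
NOTE-W-ref-2, bstw-MEMO-9 (626211cba73919ef) + addA (de517f28a83a79cc) + addB (b16856770569f647), REPORT-bstw-9.
-/

set_option autoImplicit false

noncomputable section

open scoped Classical MatrixGroups ModularForm

open CongruenceSubgroup WeierstrassCurve NumberField Literature.NumberTheory.EllipticCurves
  Literature.NumberTheory.EllipticCurves.ModularForms
  Literature.NumberTheory.EllipticCurves.Rank1Residual
  Literature.NumberTheory.EllipticCurves.Rank1Residual.Typed

namespace Summit.BirchSwinnertonDyer.Rank1Residual.Supersingular

/-! ### The class-number-free scope witness and the two S-scoped binders -/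

section Scope

/-- **The class-number-free scope witness S1 ∧ S2 (+ G3)**: a (ram) prime `q` (`BSTWScope.IsAuxiliaryPrime W p q`:
`q ≠ p`, multiplicative, `p ∤ ord_q(Δ_min)`) and an auxiliary imaginary quadratic field `L` of BSTW II §2.3 relative to
`q` (`BSTWScope.IsAuxiliaryField W p q L`: `p` split, `q` inert, `N/q` split, `2` split if good, `(d_L, 2N) = 1`) — NO
condition on `h_L`. It is `BSTWScope.HasWitness W p` with its last conjunct `¬ p ∣ h_L` dropped, and it is a THEOREM for
every semistable `W` at every odd good supersingular `p` (Theorems-side `BSTWScope_exists_auxField_of_goodSS`).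
A predicate; nothing asserted. [cite: SkinnerUrban2014, Thm. 2 (p. 3), second bullet (shape of (ram) only; nothing asserted)] -/
def BSTWScope.HasAuxWitness (W : WeierstrassCurve ℚ) [W.IsGloballyMinimal] (p : ℕ) : Prop :=
  ∃ (q : ℕ) (_ : Fact q.Prime) (L : Type) (_ : Field L) (_ : NumberField L),
    BSTWScope.IsAuxiliaryPrime W p q ∧ BSTWScope.IsAuxiliaryField W p q L

/-- A full scope witness (with `p ∤ h_L`) is in particular a class-number-free one. [folklore] -/
theorem BSTWScope.hasAuxWitness_of_hasWitness (W : WeierstrassCurve ℚ) [W.IsGloballyMinimal] (p : ℕ)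
    (h : BSTWScope.HasWitness W p) : BSTWScope.HasAuxWitness W p := by
  obtain ⟨q, hq, L, hF, hN, haux, hfield, _⟩ := h
  exact ⟨q, hq, L, hF, hN, haux, hfield⟩

/-- The dichotomy behind p438787's corner hypothesis `hα`: either there is a full scope witness (some admissible
auxiliary field has `p ∤ h_L`), or EVERY admissible auxiliary pair `(q, L)` has `p ∣ h_L`. [folklore] -/
theorem BSTWScope.hasWitness_or_forall_dvd_classNumber (W : WeierstrassCurve ℚ) [W.IsGloballyMinimal] (p : ℕ) :
    BSTWScope.HasWitness W p ∨
      ∀ (q : ℕ) (_ : Fact q.Prime) (L : Type) (_ : Field L) (_ : NumberField L),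
        BSTWScope.IsAuxiliaryPrime W p q → BSTWScope.IsAuxiliaryField W p q L →
          p ∣ NumberField.classNumber L := by
  by_cases hw : BSTWScope.HasWitness W p
  · exact Or.inl hw
  · refine Or.inr fun q hq L hF hN haux hfield => ?_
    by_contra hndvd
    exact hw ⟨q, hq, L, hF, hN, haux, hfield, hndvd⟩

/-- **OPEN BINDER — the `p ≥ 5` TIER of the cell-verified reading of Burungale–Skinner–Tian–Wan, arXiv:2409.01350v2,
Thm. 1.3 (= Part II Thm. 2.1, (KoMC_r)) WITHOUT the class-number rider (α).** "Let `E/ℚ` be a semistable elliptic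
curve, and `p > 2` a supersingular prime. … Then Kobayashi's Conjecture (Kob) is true", RESTRICTED to: `p ≥ 5`, and the
(ram) prime / auxiliary imaginary quadratic field of the printed proof (II §2.3) exist (`BSTWScope.HasAuxWitness W p` —
which they always do, `BSTWScope_exists_auxField_of_goodSS`). This is the regime of the cell bsd-ssimc's line-by-line
verification (REPORT-bstw-6 7a95ba616d84dc36, G-ledger EMPTY) with the rider (α) of NOTE-W-ref-2 REMOVED — the reading
bstw-MEMO-9 argues for («(α) void at p ≥ 5»: the bracketed finite-index variant of MEMO-6 B.1 never occurs,
`Γ_L = Γ_L^cyc × Γ_L^v` for every `L`; Rohrlich 1989 never invoked); whether it is the verification OF RECORD is the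
referee's to grade (REPORT-bstw-9). VERDICT-NEUTRAL: this `Prop` names a hypothesis, asserting nothing. Litref D-audit
of record (D-AUDIT-bstw24-r1 2ab68891cb7b08bc + ADDENDUM-1 dd57a5d99fb5bd7f + ADDENDUM-2 5fc2aa1cce88a1ac + ADDENDUM-3
f18da4daf35aa2e0, O6; module docstring): at p ≥ 5 PASS-in-cell WITH THE CELL REPAIRS (re-verified first-hand by the
litref reader; class-number-free on the auxiliary field per r1 ADDENDUM-3 — DISPUTED across desks at h_p(L) ≥ 1
(cgs25-r2 Q1 on printed Prop. 4.12, l.3385–3386; referee C R381: «counterexample VALID … INCOMPLETE as worded …, VACUOUS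
at h_p(L) = 0», final word C4's; r1 ADDENDUM-5 73386cd8: lacuna conceded and repaired by reader (Lemma S + Lemma T),
admission C4's; module docstring)), print gapped-as-printed at the §6 normalisation (factor p/(2(p+1)λ_N(g)), = the
cell's CB10 / (R1)) and at Thm. 9.24's proof l.7275–7286 (reduced to label erratum + bookkeeping by ADDENDUM-1); printed
Thm. 10.1 / §10.3 = «Part II Thm. 2.1 / §2.3». Conclusion: `KobayashiMainConjecture W p ε` for every
sign, on the tree's real objects. Strictly weaker than the printed binder (`thm13_scopedS_OPEN_of_thm13_OPEN`), stronger
than the (α)-scoped binder of record (`thm13_scoped_OPEN_of_thm13_scopedS_OPEN`). The source is an UNREFEREED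
PREPRINT: NEVER cite this `Prop` as a theorem; take it as an explicit hypothesis. Nothing asserted.
[claim: BurungaleSkinnerTianWan2024, status: under-review]
[cite: Kobayashi2003, Conjecture (Main Conjecture) (p. 2) (shape of the conclusion only; nothing asserted)] -/
def BurungaleSkinnerTianWan2024_thm13_scopedS_OPEN : Prop :=
  ∀ (W : WeierstrassCurve ℚ) [W.IsElliptic] [W.IsGloballyMinimal] (p : ℕ) [Fact p.Prime],
    5 ≤ p → Semistable W → GoodSS W p → BSTWScope.HasAuxWitness W p →
      ∀ ε : ℤˣ, KobayashiMainConjecture W p ε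

/-- **OPEN BINDER — the `p = 3` TIER of the cell's reading of Burungale–Skinner–Tian–Wan Thm. 1.3 WITHOUT the
class-number rider (α).** "… If `p = 3`, suppose that (h4) [`a_3 = 0`] holds. Then Kobayashi's Conjecture (Kob) is
true", RESTRICTED to `p = 3`, `a₃ = 0`, and the existence of the (ram) prime / auxiliary field of II §2.3
(`BSTWScope.HasAuxWitness W p`, always available). WHAT THIS TIER RESTS ON beyond the `p ≥ 5` chain: the
refereed-print replacements M1–M3 and ONE located residual without refereed print, (3-ii)♭ = Ohta's Λ-adic
Eichler–Shimura isomorphism for the full `e′H¹(Y₁(N·3^∞))` at `p = 3` (BSTW Rem. 5.1 / §3.2.3 cite the PREPRINT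
[SV-S-Ohta]; bstw-MEMO-7 1fa682b12be3a3f9, REPORT-bstw-7 40fdbe7e627732c4; flag `BSTW13-p3-OhtaES-preprint`, RELAY-6
«p = 3 rows NOT bookable on cell verification») — exactly as the `p = 3` binder of record, minus its rider (α) at 3
(bstw-MEMO-9-addB b16856770569f647 argues it void: Lemma Γ is `p`-uniform; referee REPORT-bstw-9; VERDICT-NEUTRAL
here). Litref D-audit of record (D-AUDIT-bstw24-r1 2ab68891cb7b08bc, O5; module docstring): GAP(line) at p = 3 located
at the note after Thm. 4.1 (TeX l.2915; printed §4.2.3, p. 34 — the «§3.2.3» above) and at Rem. 6.1 (TeX l.4918–4922, p.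
58 — the «Rem. 5.1» above) ⇐ [SV-S-Ohta] (unpublished, unlocated 2026-08-26) + Cais 2018 (partial). The exact twin of
`…_thm13_scopedS_OPEN` (`5 ≤ p` ↦ `p = 3 ∧ a₃ = 0`). Strictly weaker than the printed binder
(`thm13_scopedAtThreeS_OPEN_of_thm13_OPEN`), stronger than the `p = 3` binder of record
(`thm13_scopedAtThree_OPEN_of_thm13_scopedAtThreeS_OPEN`). UNREFEREED PREPRINT resting at 3 on a further preprint:
NEVER cite this `Prop` as a theorem; take it as an explicit hypothesis. Nothing asserted.
[claim: BurungaleSkinnerTianWan2024, status: under-review]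
[cite: Kobayashi2003, Conjecture (Main Conjecture) (p. 2) (shape of the conclusion only; nothing asserted)] -/
def BurungaleSkinnerTianWan2024_thm13_scopedAtThreeS_OPEN : Prop :=
  ∀ (W : WeierstrassCurve ℚ) [W.IsElliptic] [W.IsGloballyMinimal] (p : ℕ) [Fact p.Prime],
    p = 3 → Semistable W → GoodSS W p → W.frobeniusTrace 3 = 0 → BSTWScope.HasAuxWitness W p →
      ∀ ε : ℤˣ, KobayashiMainConjecture W p ε

/-- The `p ≥ 5` S-scoped binder is IMPLIED by the printed one (it only adds hypotheses) — taking it is never stronger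
than taking Thm. 1.3 as printed. [claim: BurungaleSkinnerTianWan2024, status: under-review] -/
theorem thm13_scopedS_OPEN_of_thm13_OPEN (h : BurungaleSkinnerTianWan2024_thm13_OPEN) :
    BurungaleSkinnerTianWan2024_thm13_scopedS_OPEN := by
  intro W _ _ p _ h5 hsst hss _ ε
  exact h W p (by omega) hsst hss (fun h3 => by omega) ε

/-- The `p ≥ 5` S-scoped binder IMPLIES the (α)-scoped binder of record (a full scope witness contains a
class-number-free one). [claim: BurungaleSkinnerTianWan2024, status: under-review] -/
theorem thm13_scoped_OPEN_of_thm13_scopedS_OPEN (h : BurungaleSkinnerTianWan2024_thm13_scopedS_OPEN) :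
    BurungaleSkinnerTianWan2024_thm13_scoped_OPEN := by
  intro W _ _ p _ h5 hsst hss hw ε
  exact h W p h5 hsst hss (BSTWScope.hasAuxWitness_of_hasWitness W p hw) ε

/-- The `p = 3` S-scoped binder is IMPLIED by the printed one. [claim: BurungaleSkinnerTianWan2024, status: under-review] -/
theorem thm13_scopedAtThreeS_OPEN_of_thm13_OPEN (h : BurungaleSkinnerTianWan2024_thm13_OPEN) :
    BurungaleSkinnerTianWan2024_thm13_scopedAtThreeS_OPEN := by
  intro W _ _ p _ h3 hsst hss ha3 _ ε
  exact h W p (by omega) hsst hss (fun _ => ha3) ε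

/-- The `p = 3` S-scoped binder IMPLIES the `p = 3` binder of record. [claim: BurungaleSkinnerTianWan2024, status: under-review] -/
theorem thm13_scopedAtThree_OPEN_of_thm13_scopedAtThreeS_OPEN
    (h : BurungaleSkinnerTianWan2024_thm13_scopedAtThreeS_OPEN) :
    BurungaleSkinnerTianWan2024_thm13_scopedAtThree_OPEN := by
  intro W _ _ p _ h3 hsst hss ha3 hw ε
  exact h W p h3 hsst hss ha3 (BSTWScope.hasAuxWitness_of_hasWitness W p hw) ε

/-- On the two S-scoped tiers together the printed binder's class-X6 content at every odd prime is recovered, GIVEN a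
class-number-free witness (`ClassX6 W p` = `GoodSS ∧ Semistable ∧ (5 ≤ p ∨ a₃ = 0)`). CONDITIONAL; closes nothing.
[claim: BurungaleSkinnerTianWan2024, status: under-review] [cite: Kobayashi2003, Conjecture (Main Conjecture) (p. 2)] -/
theorem X6.kobayashiMainConjecture_of_thm13_scopedS_OPEN_of_scopedAtThreeS_OPEN_of_hasAuxWitness
    (h5 : BurungaleSkinnerTianWan2024_thm13_scopedS_OPEN)
    (h3 : BurungaleSkinnerTianWan2024_thm13_scopedAtThreeS_OPEN)
    (W : WeierstrassCurve ℚ) [W.IsElliptic] [W.IsGloballyMinimal] (p : ℕ) [Fact p.Prime]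
    (hp : p ≠ 2) (hX : ClassX6 W p) (hw : BSTWScope.HasAuxWitness W p) (ε : ℤˣ) :
    KobayashiMainConjecture W p ε := by
  by_cases hp5 : 5 ≤ p
  · exact h5 W p hp5 hX.2.1 hX.1 hw ε
  · have hpP : p.Prime := Fact.out
    have hp3 : p = 3 := by
      have h2 := hpP.two_le
      interval_cases p
      · exact absurd rfl hp
      · rfl
      · exact absurd hpP (by decide)
    have ha3 : W.frobeniusTrace 3 = 0 := by
      rcases hX.2.2 with h | h
      · omega
      · exact h
    exact h3 W p hp3 hX.2.1 hX.1 ha3 hw ε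

end Scope

/-! ### Class-X6 consumers GIVEN a class-number-free witness -/

section Consumers

variable (W : WeierstrassCurve ℚ) [W.IsElliptic] [W.IsGloballyMinimal] (p : ℕ) [Fact p.Prime]

/-- **Kobayashi's main conjecture for `(E, p, ε)` on X6 at `p ≥ 5`, MODULO the `p ≥ 5` S-scoped binder and a
class-number-free witness.** CONDITIONAL; closes nothing. [claim: BurungaleSkinnerTianWan2024, status: under-review]
[cite: Kobayashi2003, Conjecture (Main Conjecture) (p. 2)] -/
theorem X6.kobayashiMainConjecture_of_thm13_scopedS_OPEN_of_hasAuxWitness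
    (h : BurungaleSkinnerTianWan2024_thm13_scopedS_OPEN) (h5 : 5 ≤ p) (hX : ClassX6 W p)
    (hw : BSTWScope.HasAuxWitness W p) (ε : ℤˣ) : KobayashiMainConjecture W p ε :=
  h W p h5 hX.2.1 hX.1 hw ε

/-- **The Eisenstein half (the crux's predicate) on X6 at `p ≥ 5`, MODULO the `p ≥ 5` S-scoped binder and a
class-number-free witness**, every sign. CONDITIONAL; closes nothing. [claim: BurungaleSkinnerTianWan2024, status: under-review]
[cite: Kobayashi2003, Conjecture (Main Conjecture) (p. 2)] -/
theorem X6.kobayashiLowerDivisibility_of_thm13_scopedS_OPEN_of_hasAuxWitness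
    (h : BurungaleSkinnerTianWan2024_thm13_scopedS_OPEN) (h5 : 5 ≤ p) (hX : ClassX6 W p)
    (hw : BSTWScope.HasAuxWitness W p) (ε : ℤˣ) : KobayashiLowerDivisibility W p ε :=
  kobayashiLowerDivisibility_of_mainConjecture
    (X6.kobayashiMainConjecture_of_thm13_scopedS_OPEN_of_hasAuxWitness W p h h5 hX hw ε)

/-- **Kobayashi's main conjecture for `(E, 3, ε)` on X6 at `p = 3`, MODULO the `p = 3` S-scoped binder and a
class-number-free witness** (`ClassX6 W 3` supplies `a₃ = 0`). CONDITIONAL; closes nothing.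
[claim: BurungaleSkinnerTianWan2024, status: under-review] [cite: Kobayashi2003, Conjecture (Main Conjecture) (p. 2)] -/
theorem X6.kobayashiMainConjecture_of_thm13_scopedAtThreeS_OPEN_of_hasAuxWitness
    (h : BurungaleSkinnerTianWan2024_thm13_scopedAtThreeS_OPEN) (h3 : p = 3) (hX : ClassX6 W p)
    (hw : BSTWScope.HasAuxWitness W p) (ε : ℤˣ) : KobayashiMainConjecture W p ε := by
  have ha3 : W.frobeniusTrace 3 = 0 := by
    rcases hX.2.2 with h5 | h0
    · omega
    · exact h0
  exact h W p h3 hX.2.1 hX.1 ha3 hw ε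

/-- **The Eisenstein half (registered stub `stub_three`'s predicate) on X6 at `p = 3`, MODULO the `p = 3` S-scoped
binder and a class-number-free witness**, every sign. CONDITIONAL; closes nothing.
[claim: BurungaleSkinnerTianWan2024, status: under-review] [cite: Kobayashi2003, Conjecture (Main Conjecture) (p. 2)] -/
theorem X6.kobayashiLowerDivisibility_of_thm13_scopedAtThreeS_OPEN_of_hasAuxWitness
    (h : BurungaleSkinnerTianWan2024_thm13_scopedAtThreeS_OPEN) (h3 : p = 3) (hX : ClassX6 W p)
    (hw : BSTWScope.HasAuxWitness W p) (ε : ℤˣ) : KobayashiLowerDivisibility W p ε :=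
  kobayashiLowerDivisibility_of_mainConjecture
    (X6.kobayashiMainConjecture_of_thm13_scopedAtThreeS_OPEN_of_hasAuxWitness W p h h3 hX hw ε)

/-- **`BSD(E,p)` on X6 ∧ {r_an = 0} at `p ≥ 5`, MODULO the `p ≥ 5` S-scoped binder and a class-number-free witness**,
the rest PUBLISHED and by name (Wuthrich Prop. 21 `hW`, Kobayashi Thm. 1.2 `h12`, B. D. Kim Cor. 3.15 `hKim`, Pollack
`hPollack`, modularity `hmod`/`hmod'`, GZK `hGZK`) through the tree's ± rank-zero road. CONDITIONAL; closes nothing.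
[claim: BurungaleSkinnerTianWan2024, status: under-review] [cite: Wuthrich2014, Prop. 21 (p. 400)]
[cite: Miller2011LMS, §1 and Def. 1.1] -/
theorem X6.bsdp_of_thm13_scopedS_OPEN_of_hasAuxWitness_of_analyticRank_eq_zero
    (h : BurungaleSkinnerTianWan2024_thm13_scopedS_OPEN)
    (hW : Wuthrich2014.sha_dvd_analyticSha)
    (h12 : Kobayashi2003.thm12_signedSelmerDual_finite_torsion)
    (hKim : BDKim2013.cor315_signedCharValue_rankZero)
    (hPollack : ∀ {N : ℕ} [NeZero N] {f : CuspForm (Gamma0 N) 2},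
      pollack_exists_plusMinusPAdicLFunction (W := W) (f := f) (p := p))
    (hmod : nonempty_modularParametrizationData) (hmod' : hasEntireLFunction_rat)
    (hGZK : rank_eq_analyticRank_of_analyticRank_le_one)
    (h5 : 5 ≤ p) (hX : ClassX6 W p) (hw : BSTWScope.HasAuxWitness W p) (h0 : W.analyticRank = 0) :
    BSDp W p :=
  X6.bsdp_of_kobayashiMainConjecture_of_analyticRank_eq_zero W p hW h12 hKim hPollack hmod hmod' hGZK
    (by omega) hX h0 (X6.kobayashiMainConjecture_of_thm13_scopedS_OPEN_of_hasAuxWitness W p h h5 hX hw 1)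

/-- **`BSD(E,3)` on X6 ∧ {r_an = 0} at `p = 3`, MODULO the `p = 3` S-scoped binder and a class-number-free witness**,
the rest PUBLISHED and by name, through the same ± rank-zero road. CONDITIONAL; closes nothing.
[claim: BurungaleSkinnerTianWan2024, status: under-review] [cite: Wuthrich2014, Prop. 21 (p. 400)]
[cite: Miller2011LMS, §1 and Def. 1.1] -/
theorem X6.bsdp_of_thm13_scopedAtThreeS_OPEN_of_hasAuxWitness_of_analyticRank_eq_zero
    (h : BurungaleSkinnerTianWan2024_thm13_scopedAtThreeS_OPEN)
    (hW : Wuthrich2014.sha_dvd_analyticSha)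
    (h12 : Kobayashi2003.thm12_signedSelmerDual_finite_torsion)
    (hKim : BDKim2013.cor315_signedCharValue_rankZero)
    (hPollack : ∀ {N : ℕ} [NeZero N] {f : CuspForm (Gamma0 N) 2},
      pollack_exists_plusMinusPAdicLFunction (W := W) (f := f) (p := p))
    (hmod : nonempty_modularParametrizationData) (hmod' : hasEntireLFunction_rat)
    (hGZK : rank_eq_analyticRank_of_analyticRank_le_one)
    (h3 : p = 3) (hX : ClassX6 W p) (hw : BSTWScope.HasAuxWitness W p) (h0 : W.analyticRank = 0) :
    BSDp W p :=
  X6.bsdp_of_kobayashiMainConjecture_of_analyticRank_eq_zero W p hW h12 hKim hPollack hmod hmod' hGZK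
    (by omega) hX h0 (X6.kobayashiMainConjecture_of_thm13_scopedAtThreeS_OPEN_of_hasAuxWitness W p h h3 hX hw 1)

/-- **`BSD(E,p)` on X6 ∧ {r_an = 1} at `p ≥ 5`, MODULO the `p ≥ 5` S-scoped binder and a class-number-free witness**,
via Burungale–Kobayashi–Ota 2024 Cor. A.5 (`hA5`, PUB, flags recorded in its docstring), modularity and GZK.
CONDITIONAL; closes nothing. [claim: BurungaleSkinnerTianWan2024, status: under-review]
[cite: BurungaleKobayashiOta2023, App. A Cor. A.5] [cite: Miller2011LMS, §1 and Def. 1.1] -/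
theorem X6.bsdp_of_thm13_scopedS_OPEN_of_hasAuxWitness_of_corA5_of_analyticRank_eq_one
    (h : BurungaleSkinnerTianWan2024_thm13_scopedS_OPEN)
    (hA5 : BurungaleKobayashiOta2024.corA5_pPart_of_signedCharIdeal_eq) (hmod : hasEntireLFunction_rat)
    (hGZK : rank_eq_analyticRank_of_analyticRank_le_one)
    (h5 : 5 ≤ p) (hX : ClassX6 W p) (hw : BSTWScope.HasAuxWitness W p) (h1 : W.analyticRank = 1) :
    BSDp W p :=
  X6.bsdp_of_kobayashiMainConjecture_of_corA5_of_analyticRank_eq_one W p hA5 hmod hGZK (by omega) hX h1 1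
    (X6.kobayashiMainConjecture_of_thm13_scopedS_OPEN_of_hasAuxWitness W p h h5 hX hw 1)

end Consumers

end Summit.BirchSwinnertonDyer.Rank1Residual.Supersingular

end
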